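import Summits.AtomisticToContinuum.FouriersLaw.Theorems.HiddenChargeMazurOddChargeExistsStubOverlapDensityLimitMoments

/-!
# Stub `stub_overlapDensityLimit` of crux `OddChargeExists` — part 3/4: the thermodynamic limit of Cesàro window sums

`--supports stmt-AtomisticToContinuum-13511` (crux `HiddenChargeMazur.OddChargeExists`, line `registered`, stub
`stub_overlapDensityLimit`). The analytic heart (`tendsto_div_of_windowSum`): if `a_N` is, up to a bounded error,
the sum over all windows `[x, x+m] ⊆ [0, N-1]` of the `μ_{N,T}`-expectations of a fixed continuous polynomially
bounded observable `F` of `m+1` sites, then `a_N / N` converges. Ingredients: `N`-uniform second moments of `F` on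
every window (part 1), the truncation `F ↦ M·clamp(F/M, ±1)` with error `≤ F²/M`, the anchor-uniform bulk
equivalence of ensembles for the bounded truncation
(`AbelThermodynamicLimit.SeriesLawAtEveryLaplaceFrequency.stub_bulkWindowEquivalence`, fed with the shift-invariant
superstable DLR state of `exists_isChainGibbsMeasure_shiftInvariant_superstable_pinnedChain`), and completeness of `ℝ`
(the Cesàro means form a Cauchy sequence).

All statements proved; `[folklore]`. No definitions, no named facts.
-/

noncomputable section

open MeasureTheory Set Function Finset Filter Topology
open scoped BigOperators

namespace Summit.AtomisticToContinuum.FouriersLaw.Theorems.OddChargeExists.OverlapDensityLimit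

open Literature.MathematicalPhysics.KineticTheory.HeatConduction OscillatorChain
open Summit.AtomisticToContinuum.FouriersLaw.Theorems.LightConeBondHeat
open Summit.AtomisticToContinuum.FouriersLaw.Theorems.NoOddCharge

/-! ### §1 The thermodynamic limit of Cesàro window sums (bulk equivalence of ensembles) -/

/-- Truncation error of the clamp: `|F - M·clamp(F/M, ±1)| ≤ F²/M` (`M > 0`). [folklore] -/
theorem abs_sub_mul_clamp_le {F M : ℝ} (hM : 0 < M) :
    |F - M * max (-1) (min 1 (F / M))| ≤ F ^ 2 / M := by
  rcases le_or_gt F (-M) with h1 | h1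
  · have hFM : F / M ≤ -1 := by rw [div_le_iff₀ hM]; linarith
    rw [min_eq_right (by linarith : F / M ≤ 1), max_eq_left hFM, mul_neg_one, sub_neg_eq_add,
      abs_of_nonpos (by linarith), le_div_iff₀ hM]
    nlinarith
  rcases le_or_gt F M with h2 | h2
  · have hlo : -1 ≤ F / M := by rw [le_div_iff₀ hM]; linarith
    have hhi : F / M ≤ 1 := by rw [div_le_iff₀ hM]; linarith
    rw [min_eq_right hhi, max_eq_right hlo, mul_div_cancel₀ _ hM.ne', sub_self, abs_zero]
    positivity
  · have hFM : 1 ≤ F / M := by rw [le_div_iff₀ hM]; linarith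
    rw [min_eq_left hFM, max_eq_right (by norm_num), mul_one, abs_of_nonneg (by linarith), le_div_iff₀ hM]
    nlinarith

section Pinned

variable {ω₂ lam β : ℝ}

/-- **Cesàro limit of window sums — the thermodynamic limit.** Let `F` be a continuous observable of
`m+1` consecutive sites with polynomial growth, and `a_N` a sequence which, up to a bounded error, is the
sum over all windows `[x, x+m] ⊆ [0, N-1]` of the expectations of `F` under the free finite-volume Gibbs
state `μ_{N,T}` of the pinned chain. Then `a_N / N` converges. Ingredients: `N`-uniform second moments
of `F` on every window (truncation `F ↦ clamp(F, ±M)` costs `≤ C/M` per window), the anchor-uniform bulk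
equivalence of ensembles for the bounded truncation (`stub_bulkWindowEquivalence`, with the
shift-invariant DLR state of `exists_isChainGibbsMeasure_shiftInvariant_superstable_pinnedChain`), and
completeness of `ℝ`. [folklore] -/
theorem tendsto_div_of_windowSum (hω : 0 < ω₂) (hl : 0 < lam) (hβ : 0 < β) {γ : ℝ} (hγ : 0 < γ) {T : ℝ}
    (hT : 0 < T) (m : ℕ) {F : PhaseSpace (m + 1) → ℝ} (hFc : Continuous F) {CF : ℝ} (hCF : 0 ≤ CF) (dF : ℕ)
    (hFb : ∀ w, |F w| ≤ CF * (1 + ∑ j : Fin (m + 1), (w.1 j ^ 2 + w.2 j ^ 2)) ^ dF)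
    {a : ℕ → ℝ} {D : ℝ} {N₁ : ℕ}
    (ha : ∀ N, N₁ ≤ N → |a N - ∑ x ∈ Finset.range (N - m),
        (if h : x + m < N then ∫ z, F (fun j : Fin (m + 1) => z.1 ⟨x + j.val, by omega⟩,
            fun j : Fin (m + 1) => z.2 ⟨x + j.val, by omega⟩) ∂((pinnedChain ω₂ lam β γ).gibbsMeasure N T)
          else 0)| ≤ D) :
    ∃ χ : ℝ, Tendsto (fun N : ℕ => a N / (N : ℝ)) atTop (𝓝 χ) := by
  set P := pinnedChain ω₂ lam β γ with hP
  have hD0 : 0 ≤ D := (abs_nonneg _).trans (ha N₁ le_rfl)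
  -- uniform second moments of the window observable
  obtain ⟨Mo, hMo⟩ := pinnedChain_gibbs_siteSum_pow_le hω hl hβ.le γ hT (m + 1) (2 * dF)
  set C₂ : ℝ := CF ^ 2 * max Mo 0 with hC₂
  have hC₂0 : 0 ≤ C₂ := by positivity
  -- per-window facts: integrability and the truncation error
  have hwin : ∀ (N x : ℕ) (hx : x + m < N),
      Integrable (fun z : PhaseSpace N => F (fun j : Fin (m + 1) => z.1 ⟨x + j.val, by omega⟩,
          fun j : Fin (m + 1) => z.2 ⟨x + j.val, by omega⟩)) (P.gibbsMeasure N T) ∧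
        ∀ M : ℝ, 0 < M →
          |(∫ z, F (fun j : Fin (m + 1) => z.1 ⟨x + j.val, by omega⟩,
              fun j : Fin (m + 1) => z.2 ⟨x + j.val, by omega⟩) ∂(P.gibbsMeasure N T)) -
            M * ∫ z, max (-1) (min 1 (F (fun j : Fin (m + 1) => z.1 ⟨x + j.val, by omega⟩,
              fun j : Fin (m + 1) => z.2 ⟨x + j.val, by omega⟩) / M)) ∂(P.gibbsMeasure N T)| ≤ C₂ / M := by
    intro N x hx
    clear ha
    haveI : IsProbabilityMeasure (P.gibbsMeasure N T) :=
      pinnedChain_isProbabilityMeasure_gibbsMeasure hω hl.le hβ.le γ N hT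
    set μ := P.gibbsMeasure N T with hμ
    set s : Fin (m + 1) → Fin N := fun j => ⟨x + j.val, by omega⟩ with hs
    set Φ : PhaseSpace N → ℝ := fun z => F (fun j : Fin (m + 1) => z.1 ⟨x + j.val, by omega⟩,
        fun j : Fin (m + 1) => z.2 ⟨x + j.val, by omega⟩) with hΦ
    have hΦc : Continuous Φ := by
      refine hFc.comp ?_
      exact (continuous_pi fun j => (continuous_apply _).comp continuous_fst).prodMk
        (continuous_pi fun j => (continuous_apply _).comp continuous_snd)
    have hΦb : ∀ z, |Φ z| ≤ CF * (1 + ∑ t : Fin (m + 1), (z.1 (s t) ^ 2 + z.2 (s t) ^ 2)) ^ dF :=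
      fun z => hFb _
    have hΦi : Integrable Φ μ := pinnedChain_integrable_gibbs_of_le_siteSum hω hl hβ.le γ hT s hΦc hCF dF hΦb
    have hΦ2b : ∀ z, |Φ z ^ 2| ≤ CF ^ 2 * (1 + ∑ t : Fin (m + 1), (z.1 (s t) ^ 2 + z.2 (s t) ^ 2)) ^ (2 * dF) := by
      intro z
      rw [abs_pow, pow_mul', ← mul_pow]
      exact pow_le_pow_left₀ (abs_nonneg _) (hΦb z) 2
    have hΦ2i : Integrable (fun z => Φ z ^ 2) μ :=
      pinnedChain_integrable_gibbs_of_le_siteSum hω hl hβ.le γ hT s (hΦc.pow 2) (by positivity) (2 * dF) hΦ2b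
    have hΦ2 : ∫ z, Φ z ^ 2 ∂μ ≤ C₂ := by
      have h1 : ∫ z, Φ z ^ 2 ∂μ ≤ ∫ z, CF ^ 2 * (1 + ∑ t : Fin (m + 1), (z.1 (s t) ^ 2 + z.2 (s t) ^ 2)) ^ (2 * dF) ∂μ :=
        integral_mono hΦ2i ((hMo N s).1.const_mul _) fun z => (le_abs_self _).trans (hΦ2b z)
      rw [integral_const_mul] at h1
      exact h1.trans (mul_le_mul_of_nonneg_left ((hMo N s).2.trans (le_max_left _ _)) (sq_nonneg _))
    refine ⟨hΦi, fun M hM => ?_⟩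
    have hfm : Measurable fun z : PhaseSpace N => max (-1) (min 1 (Φ z / M)) :=
      measurable_const.max (measurable_const.min (hΦc.measurable.div_const M))
    have hfb : ∀ z : PhaseSpace N, |max (-1) (min 1 (Φ z / M))| ≤ 1 := fun z =>
      abs_le.2 ⟨le_max_left _ _, max_le (by norm_num) (min_le_left _ _)⟩
    have hfi : Integrable (fun z : PhaseSpace N => max (-1) (min 1 (Φ z / M))) μ :=
      (integrable_const (1 : ℝ)).mono' hfm.aestronglyMeasurable
        (Eventually.of_forall fun z => by rw [Real.norm_eq_abs]; exact hfb z)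
    calc |∫ z, Φ z ∂μ - M * ∫ z, max (-1) (min 1 (Φ z / M)) ∂μ|
        = |∫ z, (Φ z - M * max (-1) (min 1 (Φ z / M))) ∂μ| := by
          rw [integral_sub hΦi (hfi.const_mul M), integral_const_mul]
      _ ≤ ∫ z, |Φ z - M * max (-1) (min 1 (Φ z / M))| ∂μ := abs_integral_le_integral_abs
      _ ≤ ∫ z, Φ z ^ 2 / M ∂μ :=
          integral_mono_of_nonneg (Eventually.of_forall fun z => abs_nonneg _) (hΦ2i.div_const M)
            (Eventually.of_forall fun z => abs_sub_mul_clamp_le hM)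
      _ = (∫ z, Φ z ^ 2 ∂μ) / M := integral_div M _
      _ ≤ C₂ / M := div_le_div_of_nonneg_right hΦ2 hM.le
  -- the infinite-volume state
  obtain ⟨μT, hG, hS, hSS⟩ := exists_isChainGibbsMeasure_shiftInvariant_superstable_pinnedChain γ hω hl.le hβ.le hT
  haveI : IsProbabilityMeasure μT := hG.1
  -- main estimate: for every `η > 0` a constant `K` with `|a N / N - K| ≤ η` eventually
  have hmain : ∀ η : ℝ, 0 < η → ∃ K : ℝ, ∃ Nη : ℕ, ∀ N, Nη ≤ N → |a N / N - K| ≤ η := by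
    intro η hη
    set M : ℝ := 4 * C₂ / η + 1 with hMdef
    have hM : 0 < M := by positivity
    have hCM : C₂ / M ≤ η / 4 := by
      rw [div_le_iff₀ hM, hMdef]
      have : η / 4 * (4 * C₂ / η + 1) = C₂ + η / 4 := by field_simp
      rw [this]; linarith
    set f : PhaseSpace (m + 1) → ℝ := fun w => max (-1) (min 1 (F w / M)) with hf
    have hfm : Measurable f := measurable_const.max (measurable_const.min (hFc.measurable.div_const M))
    have hf1 : ∀ w, |f w| ≤ 1 := fun w => abs_le.2 ⟨le_max_left _ _, max_le (by norm_num) (min_le_left _ _)⟩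
    have hε : 0 < η / 4 / M := by positivity
    obtain ⟨L, N₀, hLN⟩ :=
      Summit.AtomisticToContinuum.FouriersLaw.Theorems.AbelThermodynamicLimit.SeriesLawAtEveryLaplaceFrequency.stub_bulkWindowEquivalence
        ω₂ lam β γ hω hl hβ hγ T hT μT hG hS hSS m f hfm hf1 (η / 4 / M) hε
    set cM : ℝ := ∫ σ, f (boxPhaseAt 0 m σ) ∂μT with hcM
    have hcM1 : |cM| ≤ 1 := by
      have h := norm_integral_le_of_norm_le_const (μ := μT) (f := fun σ => f (boxPhaseAt 0 m σ)) (C := 1)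
        (Eventually.of_forall fun σ => by rw [Real.norm_eq_abs]; exact hf1 _)
      rwa [probReal_univ, mul_one, Real.norm_eq_abs] at h
    set K : ℝ := M * cM with hK
    set E₀ : ℝ := D + 2 * M * (L + L) + m * |K| with hE₀
    have hE₀0 : 0 ≤ E₀ := by positivity
    obtain ⟨Nc, hNc⟩ : ∃ Nc : ℕ, 4 * E₀ / η ≤ Nc := exists_nat_ge _
    refine ⟨K, max (max N₁ N₀) (max Nc (m + 1)), fun N hN => ?_⟩
    have hN₁ : N₁ ≤ N := le_trans (le_trans (le_max_left _ _) (le_max_left _ _)) hN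
    have hN₀ : N₀ ≤ N := le_trans (le_trans (le_max_right _ _) (le_max_left _ _)) hN
    have hNc' : (Nc : ℝ) ≤ N := by exact_mod_cast le_trans (le_trans (le_max_left _ _) (le_max_right _ _)) hN
    have hNm : m + 1 ≤ N := le_trans (le_trans (le_max_right _ _) (le_max_right _ _)) hN
    have hNpos : (0 : ℝ) < N := by exact_mod_cast (show 0 < N by omega)
    have h1 := ha N hN₁
    clear ha
    haveI : IsProbabilityMeasure (P.gibbsMeasure N T) :=
      pinnedChain_isProbabilityMeasure_gibbsMeasure hω hl.le hβ.le γ N hT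
    -- termwise estimate
    have hterm : ∀ x ∈ Finset.range (N - m),
        |(if h : x + m < N then ∫ z, F (fun j : Fin (m + 1) => z.1 ⟨x + j.val, by omega⟩,
            fun j : Fin (m + 1) => z.2 ⟨x + j.val, by omega⟩) ∂(P.gibbsMeasure N T) else 0) - K| ≤
          (C₂ / M + η / 4) + 2 * M * ((if x < L then (1 : ℝ) else 0) + (if N - m - L ≤ x then (1 : ℝ) else 0)) := by
      intro x hx
      have hxN : x + m < N := by rw [Finset.mem_range] at hx; omega
      rw [dif_pos hxN]
      obtain ⟨-, hM'⟩ := hwin N x hxN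
      have htr := hM' M hM
      have hfwm : Measurable fun z : PhaseSpace N => f (fun j : Fin (m + 1) => z.1 ⟨x + j.val, by omega⟩,
          fun j : Fin (m + 1) => z.2 ⟨x + j.val, by omega⟩) := by
        refine hfm.comp ?_
        exact ((measurable_pi_lambda _ fun j => (measurable_pi_apply _).comp measurable_fst).prodMk
          (measurable_pi_lambda _ fun j => (measurable_pi_apply _).comp measurable_snd))
      have hfint1 : |∫ z, f (fun j : Fin (m + 1) => z.1 ⟨x + j.val, by omega⟩,
          fun j : Fin (m + 1) => z.2 ⟨x + j.val, by omega⟩) ∂(P.gibbsMeasure N T)| ≤ 1 := by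
        have h := norm_integral_le_of_norm_le_const (μ := P.gibbsMeasure N T)
          (f := fun z : PhaseSpace N => f (fun j : Fin (m + 1) => z.1 ⟨x + j.val, by omega⟩,
            fun j : Fin (m + 1) => z.2 ⟨x + j.val, by omega⟩)) (C := 1)
          (Eventually.of_forall fun z => by rw [Real.norm_eq_abs]; exact hf1 _)
        rwa [probReal_univ, mul_one, Real.norm_eq_abs] at h
      have hsplit : |(∫ z, F (fun j : Fin (m + 1) => z.1 ⟨x + j.val, by omega⟩,
            fun j : Fin (m + 1) => z.2 ⟨x + j.val, by omega⟩) ∂(P.gibbsMeasure N T)) - K| ≤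
          C₂ / M + M * |(∫ z, f (fun j : Fin (m + 1) => z.1 ⟨x + j.val, by omega⟩,
            fun j : Fin (m + 1) => z.2 ⟨x + j.val, by omega⟩) ∂(P.gibbsMeasure N T)) - cM| := by
        rw [hK]
        refine (abs_sub_le _ _ _).trans (add_le_add htr ?_)
        rw [← mul_sub, abs_mul, abs_of_pos hM]
      by_cases hdeep : L ≤ x ∧ x + m + L < N
      · have hb : |(∫ z, f (fun j : Fin (m + 1) => z.1 ⟨x + j.val, by omega⟩,
            fun j : Fin (m + 1) => z.2 ⟨x + j.val, by omega⟩) ∂(P.gibbsMeasure N T)) - cM| ≤ η / 4 / M :=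
          hLN N hN₀ ⟨x, by omega⟩ hdeep.1 hdeep.2
        have hMb : M * |(∫ z, f (fun j : Fin (m + 1) => z.1 ⟨x + j.val, by omega⟩,
            fun j : Fin (m + 1) => z.2 ⟨x + j.val, by omega⟩) ∂(P.gibbsMeasure N T)) - cM| ≤ η / 4 := by
          calc _ ≤ M * (η / 4 / M) := mul_le_mul_of_nonneg_left hb hM.le
            _ = η / 4 := by field_simp
        have hind : (0 : ℝ) ≤ 2 * M * ((if x < L then (1 : ℝ) else 0) + (if N - m - L ≤ x then (1 : ℝ) else 0)) := by
          have h1 : (0 : ℝ) ≤ (if x < L then (1 : ℝ) else 0) := by split_ifs <;> norm_num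
          have h2 : (0 : ℝ) ≤ (if N - m - L ≤ x then (1 : ℝ) else 0) := by split_ifs <;> norm_num
          positivity
        linarith
      · have hind : (1 : ℝ) ≤ (if x < L then (1 : ℝ) else 0) + (if N - m - L ≤ x then (1 : ℝ) else 0) := by
          rw [not_and_or, not_le, not_lt] at hdeep
          rcases hdeep with h1 | h2
          · rw [if_pos h1]; split_ifs <;> norm_num
          · have h3 : N - m - L ≤ x := by omega
            rw [if_pos h3]; split_ifs <;> norm_num
        have hMb : M * |(∫ z, f (fun j : Fin (m + 1) => z.1 ⟨x + j.val, by omega⟩,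
            fun j : Fin (m + 1) => z.2 ⟨x + j.val, by omega⟩) ∂(P.gibbsMeasure N T)) - cM| ≤ 2 * M * 1 := by
          have h := abs_sub (∫ z, f (fun j : Fin (m + 1) => z.1 ⟨x + j.val, by omega⟩,
            fun j : Fin (m + 1) => z.2 ⟨x + j.val, by omega⟩) ∂(P.gibbsMeasure N T)) cM
          have h2 : |(∫ z, f (fun j : Fin (m + 1) => z.1 ⟨x + j.val, by omega⟩,
              fun j : Fin (m + 1) => z.2 ⟨x + j.val, by omega⟩) ∂(P.gibbsMeasure N T)) - cM| ≤ 2 := by linarith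
          calc _ ≤ M * 2 := mul_le_mul_of_nonneg_left h2 hM.le
            _ = 2 * M * 1 := by ring
        have h2M : 2 * M * 1 ≤ 2 * M * ((if x < L then (1 : ℝ) else 0) + (if N - m - L ≤ x then (1 : ℝ) else 0)) :=
          mul_le_mul_of_nonneg_left hind (by positivity)
        linarith
    -- counting the boundary windows
    have hc1 : ∑ x ∈ Finset.range (N - m), (if x < L then (1 : ℝ) else 0) ≤ L := by
      rw [Finset.sum_boole]
      have h : ((Finset.range (N - m)).filter (fun x => x < L)).card ≤ (Finset.range L).card :=
        Finset.card_le_card fun x hx => by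
          simp only [Finset.mem_filter, Finset.mem_range] at hx ⊢
          exact hx.2
      rw [Finset.card_range] at h
      exact_mod_cast h
    have hc2 : ∑ x ∈ Finset.range (N - m), (if N - m - L ≤ x then (1 : ℝ) else 0) ≤ L := by
      rw [Finset.sum_boole]
      have h : ((Finset.range (N - m)).filter (fun x => N - m - L ≤ x)).card ≤ (Finset.Ico (N - m - L) (N - m)).card :=
        Finset.card_le_card fun x hx => by
          simp only [Finset.mem_filter, Finset.mem_range, Finset.mem_Ico] at hx ⊢
          exact ⟨hx.2, hx.1⟩
      rw [Nat.card_Ico] at h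
      have h3 : N - m - (N - m - L) ≤ L := by omega
      exact_mod_cast h.trans h3
    -- summing
    have hsum : |∑ x ∈ Finset.range (N - m), ((if h : x + m < N then ∫ z, F (fun j : Fin (m + 1) => z.1 ⟨x + j.val, by omega⟩,
            fun j : Fin (m + 1) => z.2 ⟨x + j.val, by omega⟩) ∂(P.gibbsMeasure N T) else 0) - K)| ≤
        ((N - m : ℕ) : ℝ) * (C₂ / M + η / 4) + 2 * M * (L + L) := by
      refine (Finset.abs_sum_le_sum_abs _ _).trans ((Finset.sum_le_sum hterm).trans ?_)
      rw [Finset.sum_add_distrib, Finset.sum_const, Finset.card_range, nsmul_eq_mul, ← Finset.mul_sum,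
        Finset.sum_add_distrib]
      have h2M : (0 : ℝ) ≤ 2 * M := by positivity
      have h3 := mul_le_mul_of_nonneg_left (add_le_add hc1 hc2) h2M
      linarith
    have hNm' : ((N - m : ℕ) : ℝ) = N - m := by rw [Nat.cast_sub (by omega)]
    rw [Finset.sum_sub_distrib, Finset.sum_const, Finset.card_range, nsmul_eq_mul] at hsum
    -- abstract the window sum: pure real bookkeeping from here on
    generalize hS : (∑ x ∈ Finset.range (N - m), (if h : x + m < N then ∫ z, F (fun j : Fin (m + 1) => z.1 ⟨x + j.val, by omega⟩,
        fun j : Fin (m + 1) => z.2 ⟨x + j.val, by omega⟩) ∂(P.gibbsMeasure N T) else 0)) = S at h1 hsum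
    have hfinal : |a N - N * K| ≤ N * (C₂ / M + η / 4) + E₀ := by
      have e : a N - N * K = (a N - S) + (S - ((N - m : ℕ) : ℝ) * K) - m * K := by rw [hNm']; ring
      rw [e]
      have hmK : |(m : ℝ) * K| = m * |K| := by rw [abs_mul, Nat.abs_cast]
      have hnn : (0 : ℝ) ≤ C₂ / M + η / 4 := by positivity
      have hle : ((N - m : ℕ) : ℝ) * (C₂ / M + η / 4) ≤ N * (C₂ / M + η / 4) := by
        rw [hNm', sub_mul]
        linarith [mul_nonneg (Nat.cast_nonneg (α := ℝ) m) hnn]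
      calc |(a N - S) + (S - ((N - m : ℕ) : ℝ) * K) - m * K|
          ≤ |a N - S| + |S - ((N - m : ℕ) : ℝ) * K| + |(m : ℝ) * K| :=
            (abs_sub _ _).trans (add_le_add (abs_add_le _ _) le_rfl)
        _ ≤ D + (((N - m : ℕ) : ℝ) * (C₂ / M + η / 4) + 2 * M * (L + L)) + m * |K| := by
            rw [hmK]; exact add_le_add (add_le_add h1 hsum) le_rfl
        _ ≤ N * (C₂ / M + η / 4) + E₀ := by rw [hE₀]; linarith
    have hE : E₀ ≤ η / 4 * N := by
      have h := (div_le_iff₀ hη).1 (hNc.trans hNc')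
      linarith
    rw [show a N / N - K = (a N - N * K) / N by field_simp, abs_div, abs_of_pos hNpos, div_le_iff₀ hNpos]
    calc |a N - N * K| ≤ N * (C₂ / M + η / 4) + E₀ := hfinal
      _ ≤ N * (η / 4 + η / 4) + η / 4 * N := by gcongr
      _ ≤ η * N := by linarith [mul_pos hη hNpos]
  -- Cauchy, hence convergent
  have hcs : CauchySeq fun N : ℕ => a N / (N : ℝ) := by
    refine Metric.cauchySeq_iff'.2 fun ε hε => ?_
    obtain ⟨K, Nη, hK⟩ := hmain (ε / 4) (by positivity)
    refine ⟨Nη, fun n hn => ?_⟩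
    rw [Real.dist_eq]
    calc |a n / n - a Nη / Nη| ≤ |a n / n - K| + |K - a Nη / Nη| := abs_sub_le _ _ _
      _ ≤ ε / 4 + ε / 4 := add_le_add (hK n hn) (by rw [abs_sub_comm]; exact hK Nη le_rfl)
      _ < ε := by linarith
  exact cauchySeq_tendsto_of_complete hcs

end Pinned

/-- **Registered sub-goal `stub_overlapDensityLimit_cesaro`** (part 3 of `stub_overlapDensityLimit`): the thermodynamic
limit of Cesàro window sums — the closed form of `tendsto_div_of_windowSum`. -/
theorem stub_overlapDensityLimit_cesaro : ∀ ω₂ lam β γ T : ℝ, 0 < ω₂ → 0 < lam → 0 < β → 0 < γ → 0 < T → ∀ (m : ℕ) (F : Literature.MathematicalPhysics.KineticTheory.HeatConduction.PhaseSpace (m + 1) → ℝ), Continuous F → ∀ (CF : ℝ), 0 ≤ CF → ∀ (dF : ℕ), (∀ w : Literature.MathematicalPhysics.KineticTheory.HeatConduction.PhaseSpace (m + 1), |F w| ≤ CF * (1 + ∑ j : Fin (m + 1), (w.1 j ^ 2 + w.2 j ^ 2)) ^ dF) → ∀ (a : ℕ → ℝ) (D : ℝ) (N₁ : ℕ), (∀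 N : ℕ, N₁ ≤ N → |a N - ∑ x ∈ Finset.range (N - m), (if h : x + m < N then ∫ z, F (fun j : Fin (m + 1) => z.1 ⟨x + j.val, by omega⟩, fun j : Fin (m + 1) => z.2 ⟨x + j.val, by omega⟩) ∂((Literature.MathematicalPhysics.KineticTheory.HeatConduction.pinnedChain ω₂ lam β γ).gibbsMeasure N T) else 0)| ≤ D) → ∃ χ : ℝ, Filter.Tendsto (fun N : ℕ => a N / (N : ℝ)) Filter.atTop (nhds χ) :=
  fun _ _ _ _ _ hω hl hβ hγ hT m _ hFc _ hCF dF hFb a D N₁ ha =>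
    tendsto_div_of_windowSum hω hl hβ hγ hT m hFc hCF dF hFb (a := a) (D := D) (N₁ := N₁) ha

end Summit.AtomisticToContinuum.FouriersLaw.Theorems.OddChargeExists.OverlapDensityLimit

end
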